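import Literature.Geometry.Riemannian.AHChartConstants
import Mathlib.Analysis.Calculus.MeanValue
import Mathlib.Analysis.Calculus.Deriv.MeanValue
import Mathlib.Topology.Algebra.Order.Field
import HarnessLib

/-!
# The asymptotically hyperbolic normalisation off the boundary: estimates in a boundary chart

Support file (everything proved, no definitions, no named facts) for the comparison between the
distance function `t = dist_g(p, ·)` of a conformally compact, boundary-normalised filling
`(N, g)`, `j^* ḡ = (ρ ∘ j)² g`, `|dρ|_ḡ = 1` on `∂X` (the package
`Literature.Geometry.Riemannian.IsConformallyCompactFilling`), and its boundary defining function,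
`|t + log (ρ ∘ j)| ≤ C` — Li–Qing–Shi 2017, p. 11: "it is easily seen that `u = r − t` is bounded
on `Xⁿ`", `r = −log (x/2)`, an input of §§4–6 there and hence of the proof of
`Literature.Geometry.Riemannian.liQingShi_pinching_five` (Thm. 1.8). In the tree's package the
defining function `ρ` is not geodesic and the normalisation `|dρ|_ḡ = 1` is only imposed ON the
boundary, so the first step is to propagate it off the boundary quantitatively:
`|dρ|²_ḡ = 1 + O(ρ)`. This file is the pure finite-dimensional calculus of that step, in the
model `ℝ^ι` of a boundary chart with boundary hyperplane `{x | x i₀ = 0}` and half-space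
`{x | 0 ≤ x i₀}` (for `ι = Fin (k+1)`, `i₀ = 0` this is `range (𝓡∂ (k + 1))`).

* `apply_nonneg_of_hasFDerivWithinAt_of_le` — sign of a one-sided directional derivative at a
  minimum: if `f` has derivative `f'` within `s` at `y`, `y + t a ∈ s` and `f y ≤ f (y + t a)`
  for small `t > 0`, then `0 ≤ f' a`.
* `sq_apply_le_mul_apply_of_nonneg` — Cauchy–Schwarz `B(a,b)² ≤ B(a,a) B(b,b)` for a symmetric
  positive semidefinite continuous bilinear form.
* `exists_normalization_constants` — **the estimates**. Data: a set `S` of unique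
  differentiability in the half-space, a neighbourhood of `x₀` (a boundary point, `x₀ i₀ = 0`)
  within the half-space; an open `U ∋ x₀`; on `S ∩ U` a `C²` function `r ≥ 0` (the defining
  function read in the chart) and a `C¹` field `Q` of symmetric positive definite bilinear forms
  (the compactified metric read in the chart) such that at the boundary points `x` of `S ∩ U`
  (`x i₀ = 0`) `r x = 0` and there is `ν` with `Q_x(ν, ν) = 1`, `Q_x(ν, ·) = D_S r(x)` (the unit
  normal; conjunct (8) of the package). Conclusion: there are `δ > 0` and `A, B ≥ 0` such that the
  half-ball `{0 ≤ x i₀} ∩ B(x₀, δ)` lies in `S ∩ U` and at each of its points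
  (a) `x i₀ ≤ A · r x` (the defining function dominates the boundary coordinate),
  (b) `(D_S r(x) a)² ≤ (1 + B · r x) · Q_x(a, a)` for every `a` (`|dρ|²_ḡ ≤ 1 + O(ρ)`),
  (c) `Q_x(a, a) = 1` and `1 − B · r x ≤ D_S r(x) a` for some `a` (`|dρ|_ḡ ≥ 1 − O(ρ)`).
  Proof: at a boundary point `y`, `r ≥ 0 = r y` forces `D_S r(y)` to vanish on the hyperplane and
  to equal `θ · (x ↦ x i₀)` with `θ = 1 / ν i₀ ≥ √m` (`m` the ellipticity constant of `Q`); along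
  the vertical segment from the boundary projection `x̄` of `x` to `x` (length `x i₀`) the mean
  value theorem for `r` gives (a), and the Lipschitz bounds for `Q` and `D r` (uniform bounds on
  `DQ`, `D²r` on a compact half-ball, `SimpleAH.exists_ellipticity_of_isCompact`) transport the
  identities `D_S r(x̄) = Q_x̄(ν̄, ·)`, `Q_x̄(ν̄, ν̄) = 1` and Cauchy–Schwarz at `x̄` to `x`, giving
  (b) and (c). No inverse metric is needed.

## References

* G. Li, J. Qing, Y. Shi, *Gap phenomena and curvature estimates for conformally compact
  Einstein manifolds*, Trans. AMS 369 (2017), Def. 2.1 (p. 6) and p. 11. [LiQingShi2017]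
* C. R. Graham, C. Guillarmou, P. Stefanov, G. Uhlmann, Ann. Inst. Fourier 69 (2019), §2.1
  (asymptotically hyperbolic normalisation `|dρ|_{ρ²g} = 1` on `∂M`). [GrahamEtAl2020]
-/

noncomputable section

open Set Filter Function Metric
open scoped Topology ContDiff

namespace Literature.Geometry.Riemannian

namespace ConformallyCompact

set_option maxSynthPendingDepth 3

/-! ### Two elementary lemmas -/

section Elementary

variable {E : Type*} [NormedAddCommGroup E] [NormedSpace ℝ E]

/-- **Sign of a one-sided directional derivative at a minimum.** If `f` has derivative `f'`
within `s` at `y`, and for all small `t > 0` the point `y + t a` lies in `s` with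
`f y ≤ f (y + t a)`, then `0 ≤ f' a` (the difference quotients `t⁻¹ (f (y + t a) − f y) ≥ 0`
converge to `f' a`, Mathlib's `HasFDerivWithinAt.lim`). [folklore] -/
theorem apply_nonneg_of_hasFDerivWithinAt_of_le {f : E → ℝ} {f' : E →L[ℝ] ℝ} {s : Set E}
    {y a : E} (hf : HasFDerivWithinAt f f' s y) (hmem : ∀ᶠ t in 𝓝[>] (0 : ℝ), y + t • a ∈ s)
    (hmin : ∀ᶠ t in 𝓝[>] (0 : ℝ), f y ≤ f (y + t • a)) : 0 ≤ f' a := by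
  have hd : Tendsto (fun t : ℝ ↦ t • a) (𝓝[>] (0 : ℝ)) (𝓝 0) := by
    have h : Tendsto (fun t : ℝ ↦ t • a) (𝓝 0) (𝓝 ((0 : ℝ) • a)) :=
      tendsto_id.smul tendsto_const_nhds
    rw [zero_smul] at h
    exact h.mono_left nhdsWithin_le_nhds
  have hcd : Tendsto (fun t : ℝ ↦ t⁻¹ • t • a) (𝓝[>] (0 : ℝ)) (𝓝 a) := by
    apply tendsto_const_nhds.congr'
    filter_upwards [self_mem_nhdsWithin] with t ht
    rw [smul_smul, inv_mul_cancel₀ (ne_of_gt ht), one_smul]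
  have hlim := hf.lim (l := 𝓝[>] (0 : ℝ)) (c := fun t ↦ t⁻¹) (d := fun t ↦ t • a) (v := a)
    hd hmem hcd
  refine ge_of_tendsto hlim ?_
  filter_upwards [hmin, self_mem_nhdsWithin] with t ht ht0
  have ht0' : (0 : ℝ) < t := ht0
  rw [smul_eq_mul]
  exact mul_nonneg (inv_nonneg.2 ht0'.le) (sub_nonneg.2 ht)

/-- **Cauchy–Schwarz** for a symmetric positive semidefinite continuous bilinear form:
`B(a, b)² ≤ B(a, a) B(b, b)`. [folklore] -/
theorem sq_apply_le_mul_apply_of_nonneg (B : E →L[ℝ] E →L[ℝ] ℝ) (hsymm : ∀ a b, B a b = B b a)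
    (hpos : ∀ a, 0 ≤ B a a) (a b : E) : (B a b) ^ 2 ≤ B a a * B b b := by
  have hquad : ∀ t : ℝ, 0 ≤ B b b * (t * t) + (-(2 * B a b)) * t + B a a := by
    intro t
    have h := hpos (a - t • b)
    have hexp : B (a - t • b) (a - t • b) = B b b * (t * t) + (-(2 * B a b)) * t + B a a := by
      simp only [map_sub, map_smul, sub_apply, smul_apply, smul_eq_mul, hsymm b a]
      ring
    linarith
  by_cases hb : B b b = 0
  · have hab : B a b = 0 := by
      by_contra h
      have h1 := hquad ((B a a + 1) / (2 * B a b))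
      rw [hb] at h1
      have h2 : -(2 * B a b) * ((B a a + 1) / (2 * B a b)) = -(B a a + 1) := by
        field_simp
      rw [h2] at h1
      linarith [hpos a]
    rw [hab, hb]
    simp
  · have hbpos : 0 < B b b := lt_of_le_of_ne (hpos b) (Ne.symm hb)
    have h := discrim_le_zero hquad
    simp only [discrim] at h
    nlinarith [h, hbpos]

end Elementary

/-! ### Coordinate geometry of the model half-space `{x : ℝ^ι | 0 ≤ x i₀}` -/

section Coord

variable {ι : Type*} [Fintype ι] [DecidableEq ι] (i₀ : ι)

/-- The coordinate vector `e = single i₀ 1` has norm one. [folklore] -/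
theorem norm_single_one : ‖(EuclideanSpace.single i₀ (1 : ℝ) : EuclideanSpace ℝ ι)‖ = 1 := by
  simp

/-- `‖c • e‖ = |c|` for the unit coordinate vector `e = single i₀ 1`. [folklore] -/
theorem norm_smul_single_one (c : ℝ) :
    ‖c • (EuclideanSpace.single i₀ (1 : ℝ) : EuclideanSpace ℝ ι)‖ = |c| := by
  rw [norm_smul, norm_single_one, mul_one, Real.norm_eq_abs]

omit [Fintype ι] in
/-- The boundary projection `x̄ = x − (x i₀) e` lies on the hyperplane `{x i₀ = 0}`. [folklore] -/
theorem sub_smul_single_apply_self (x : EuclideanSpace ℝ ι) :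
    (x - x i₀ • (EuclideanSpace.single i₀ (1 : ℝ) : EuclideanSpace ℝ ι)) i₀ = 0 := by
  simp

omit [Fintype ι] in
/-- The boundary projection does not change the other coordinates. [folklore] -/
theorem sub_smul_single_apply_of_ne (x : EuclideanSpace ℝ ι) {i : ι} (hi : i ≠ i₀) :
    (x - x i₀ • (EuclideanSpace.single i₀ (1 : ℝ) : EuclideanSpace ℝ ι)) i = x i := by
  simp [hi]

/-- The boundary projection does not increase the norm: `‖x − (x i₀) e‖ ≤ ‖x‖`. [folklore] -/
theorem norm_sub_smul_single_le (x : EuclideanSpace ℝ ι) :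
    ‖x - x i₀ • (EuclideanSpace.single i₀ (1 : ℝ) : EuclideanSpace ℝ ι)‖ ≤ ‖x‖ := by
  have hsq : ‖x - x i₀ • (EuclideanSpace.single i₀ (1 : ℝ) : EuclideanSpace ℝ ι)‖ ^ 2 ≤
      ‖x‖ ^ 2 := by
    rw [EuclideanSpace.real_norm_sq_eq, EuclideanSpace.real_norm_sq_eq]
    refine Finset.sum_le_sum fun i _ ↦ ?_
    by_cases hi : i = i₀
    · subst hi
      rw [sub_smul_single_apply_self, zero_pow two_ne_zero]
      exact sq_nonneg _
    · rw [sub_smul_single_apply_of_ne i₀ x hi]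
  exact (pow_le_pow_iff_left₀ (norm_nonneg _) (norm_nonneg _) two_ne_zero).1 hsq

omit [Fintype ι] [DecidableEq ι] in
/-- The half-space `{0 ≤ x i₀}` is convex. [folklore] -/
theorem convex_halfSpace : Convex ℝ {x : EuclideanSpace ℝ ι | 0 ≤ x i₀} := by
  intro x hx y hy a b ha hb _
  simp only [mem_setOf_eq, PiLp.add_apply, PiLp.smul_apply, smul_eq_mul] at hx hy ⊢
  positivity

omit [Fintype ι] [DecidableEq ι] in
/-- The coordinate `x ↦ x i₀` is continuous. [folklore] -/
theorem continuous_apply_coord : Continuous fun x : EuclideanSpace ℝ ι ↦ x i₀ :=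
  (EuclideanSpace.proj (𝕜 := ℝ) i₀).continuous

end Coord

/-! ### The estimates in a boundary chart -/

section Estimates

variable {ι : Type*} [Fintype ι] [DecidableEq ι] {i₀ : ι}

set_option maxHeartbeats 800000 in
/-- **The asymptotically hyperbolic normalisation off the boundary, in a boundary chart.**
See the module docstring: from `r ∈ C²`, `r ≥ 0`, `Q ∈ C¹` symmetric positive definite on
`S ∩ U`, and, at boundary points, `r = 0` and a `Q`-unit vector `ν` with `Q(ν, ·) = D_S r`, one
gets `δ > 0`, `A, B ≥ 0` with `{0 ≤ x i₀} ∩ B(x₀, δ) ⊆ S ∩ U` and, on that half-ball,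
(a) `x i₀ ≤ A r x`, (b) `(D_S r(x) a)² ≤ (1 + B r x) Q_x(a,a)`,
(c) `∃ a, Q_x(a,a) = 1 ∧ 1 − B r x ≤ D_S r(x) a`. [folklore] -/
theorem exists_normalization_constants {S U : Set (EuclideanSpace ℝ ι)}
    (hSr : S ⊆ {x | 0 ≤ x i₀}) (hS : UniqueDiffOn ℝ S) {x₀ : EuclideanSpace ℝ ι} (hx₀ : x₀ ∈ S)
    (hx₀0 : x₀ i₀ = 0) (hSn : S ∈ 𝓝[{x | 0 ≤ x i₀}] x₀) (hU : IsOpen U) (hxU : x₀ ∈ U)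
    {r : EuclideanSpace ℝ ι → ℝ} (hr : ContDiffOn ℝ 2 r (S ∩ U)) (hr0 : ∀ x ∈ S ∩ U, 0 ≤ r x)
    {Q : EuclideanSpace ℝ ι → EuclideanSpace ℝ ι →L[ℝ] EuclideanSpace ℝ ι →L[ℝ] ℝ}
    (hQ : ContDiffOn ℝ 1 Q (S ∩ U)) (hQsymm : ∀ x ∈ S ∩ U, ∀ a b, Q x a b = Q x b a)
    (hQpos : ∀ x ∈ S ∩ U, ∀ a, a ≠ 0 → 0 < Q x a a)
    (hbd : ∀ x ∈ S ∩ U, x i₀ = 0 →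
      r x = 0 ∧ ∃ ν, Q x ν ν = 1 ∧ ∀ a, Q x ν a = fderivWithin ℝ r S x a) :
    ∃ δ A B : ℝ, 0 < δ ∧ 0 ≤ A ∧ 0 ≤ B ∧ {x | 0 ≤ x i₀} ∩ ball x₀ δ ⊆ S ∩ U ∧
      ∀ x ∈ {x : EuclideanSpace ℝ ι | 0 ≤ x i₀} ∩ ball x₀ δ,
        x i₀ ≤ A * r x ∧
        (∀ a, (fderivWithin ℝ r S x a) ^ 2 ≤ (1 + B * r x) * Q x a a) ∧
        (∃ a, Q x a a = 1 ∧ 1 - B * r x ≤ fderivWithin ℝ r S x a) := by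
  -- notation: the half-space `H`, the unit coordinate vector `e`
  set H : Set (EuclideanSpace ℝ ι) := {x | 0 ≤ x i₀}
  set e : EuclideanSpace ℝ ι := EuclideanSpace.single i₀ (1 : ℝ) with he_def
  have he1 : ‖e‖ = 1 := norm_single_one i₀
  have hei : e i₀ = 1 := by simp [he_def]
  have hHc : IsClosed H := isClosed_le continuous_const (continuous_apply_coord i₀)
  have hHconv : Convex ℝ H := convex_halfSpace i₀
  -- the set `T = S ∩ U` and the derivatives within it
  set T : Set (EuclideanSpace ℝ ι) := S ∩ U with hT_def
  have hT : UniqueDiffOn ℝ T := hS.inter hU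
  have hx₀T : x₀ ∈ T := ⟨hx₀, hxU⟩
  set r' : EuclideanSpace ℝ ι → EuclideanSpace ℝ ι →L[ℝ] ℝ := fderivWithin ℝ r T with hr'_def
  set r'' : EuclideanSpace ℝ ι → EuclideanSpace ℝ ι →L[ℝ] EuclideanSpace ℝ ι →L[ℝ] ℝ :=
    fderivWithin ℝ r' T
  set Q' := fderivWithin ℝ Q T
  have h12 : (1 : ℕ∞ω) + 1 ≤ 2 := by norm_num
  have hr1 : ContDiffOn ℝ 1 r' T := hr.fderivWithin hT h12
  have hrc : ContinuousOn r T := hr.continuousOn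
  have hr'c : ContinuousOn r' T := hr.continuousOn_fderivWithin hT (by norm_num)
  have hr''c : ContinuousOn r'' T := hr1.continuousOn_fderivWithin hT le_rfl
  have hQc : ContinuousOn Q T := hQ.continuousOn
  have hQ'c : ContinuousOn Q' T := hQ.continuousOn_fderivWithin hT le_rfl
  have hrdT : ∀ x ∈ T, DifferentiableWithinAt ℝ r T x := fun x hx ↦
    (hr x hx).differentiableWithinAt (by norm_num)
  have hr'dT : ∀ x ∈ T, DifferentiableWithinAt ℝ r' T x := fun x hx ↦
    (hr1 x hx).differentiableWithinAt one_ne_zero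
  have hQdT : ∀ x ∈ T, DifferentiableWithinAt ℝ Q T x := fun x hx ↦
    (hQ x hx).differentiableWithinAt one_ne_zero
  -- `r' = D_S r` on `T`
  have hr'S : ∀ x ∈ T, r' x = fderivWithin ℝ r S x := fun x hx ↦ by
    rw [hr'_def, hT_def, fderivWithin_inter (hU.mem_nhds hx.2)]
  -- a compact convex half-ball `K = closedBall x₀ δ₁ ∩ H ⊆ T`
  have hTn : T ∈ 𝓝[H] x₀ := inter_mem hSn (mem_nhdsWithin_of_mem_nhds (hU.mem_nhds hxU))
  obtain ⟨δ₁, hδ₁, hδ₁T⟩ : ∃ δ₁ > 0, closedBall x₀ δ₁ ∩ H ⊆ T := by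
    rcases (nhdsWithin_hasBasis nhds_basis_closedBall H).mem_iff.1 hTn with ⟨δ₁, hδ₁, h⟩
    exact ⟨δ₁, hδ₁, h⟩
  set K : Set (EuclideanSpace ℝ ι) := closedBall x₀ δ₁ ∩ H with hK_def
  have hKc : IsCompact K := (isCompact_closedBall x₀ δ₁).inter_right hHc
  have hKT : K ⊆ T := hδ₁T
  have hKconv : Convex ℝ K := (convex_closedBall x₀ δ₁).inter hHconv
  have hx₀K : x₀ ∈ K := ⟨mem_closedBall_self hδ₁.le, hSr hx₀⟩
  -- `K` has nonempty interior, hence unique differentiability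
  have hKint : (interior K).Nonempty := by
    refine ⟨x₀ + (δ₁ / 2) • e, ?_⟩
    rw [hK_def, interior_inter]
    constructor
    · rw [interior_closedBall x₀ hδ₁.ne', mem_ball, dist_eq_norm, add_sub_cancel_left,
        norm_smul_single_one, abs_of_pos (half_pos hδ₁)]
      linarith only [hδ₁]
    · have hopen : IsOpen {x : EuclideanSpace ℝ ι | 0 < x i₀} :=
        isOpen_lt continuous_const (continuous_apply_coord i₀)
      have hsub : {x : EuclideanSpace ℝ ι | 0 < x i₀} ⊆ H := fun x hx ↦
        show (0 : ℝ) ≤ x i₀ from le_of_lt hx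
      apply interior_mono hsub
      rw [hopen.interior_eq]
      show 0 < (x₀ + (δ₁ / 2) • e) i₀
      simp [hx₀0, he_def, hδ₁]
  have hKud : UniqueDiffOn ℝ K := uniqueDiffOn_convex hKconv hKint
  -- uniform bounds on `K`
  obtain ⟨C₁, hC₁⟩ := hKc.exists_bound_of_continuousOn (hQ'c.mono hKT)
  obtain ⟨C₂, hC₂⟩ := hKc.exists_bound_of_continuousOn (hr''c.mono hKT)
  obtain ⟨Cr, hCr⟩ := hKc.exists_bound_of_continuousOn (hr'c.mono hKT)
  have hC₁0 : 0 ≤ C₁ := (norm_nonneg _).trans (hC₁ x₀ hx₀K)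
  have hC₂0 : 0 ≤ C₂ := (norm_nonneg _).trans (hC₂ x₀ hx₀K)
  have hCr0 : 0 ≤ Cr := (norm_nonneg _).trans (hCr x₀ hx₀K)
  obtain ⟨m, hm, hmQ⟩ := SimpleAH.exists_ellipticity_of_isCompact hKc (hQc.mono hKT)
    (fun x hx a ha ↦ hQpos x (hKT hx) a ha)
  have hsm : 0 < Real.sqrt m := Real.sqrt_pos.2 hm
  -- Lipschitz bounds on the convex set `K`
  have hQlip : ∀ x ∈ K, ∀ y ∈ K, ‖Q y - Q x‖ ≤ C₁ * ‖y - x‖ := by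
    intro x hx y hy
    refine hKconv.norm_image_sub_le_of_norm_fderivWithin_le (fun z hz ↦ (hQdT z (hKT hz)).mono hKT)
      (fun z hz ↦ ?_) hx hy
    rw [fderivWithin_subset hKT (hKud z hz) (hQdT z (hKT hz))]
    exact hC₁ z hz
  have hr'lip : ∀ x ∈ K, ∀ y ∈ K, ‖r' y - r' x‖ ≤ C₂ * ‖y - x‖ := by
    intro x hx y hy
    refine hKconv.norm_image_sub_le_of_norm_fderivWithin_le
      (fun z hz ↦ (hr'dT z (hKT hz)).mono hKT) (fun z hz ↦ ?_) hx hy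
    rw [fderivWithin_subset hKT (hKud z hz) (hr'dT z (hKT hz))]
    exact hC₂ z hz
  -- the radius
  set δ : ℝ := min (min (δ₁ / 2) 1) (min (Real.sqrt m / (2 * (C₂ + 1))) (m / (2 * (C₁ + 1))))
  have hδpos : 0 < δ := by
    refine lt_min (lt_min (half_pos hδ₁) one_pos) (lt_min ?_ ?_)
    · exact div_pos hsm (by positivity)
    · exact div_pos hm (by positivity)
  have hδ₁2 : δ ≤ δ₁ / 2 := (min_le_left _ _).trans (min_le_left _ _)
  have hδ1 : δ ≤ 1 := (min_le_left _ _).trans (min_le_right _ _)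
  have hδC₂ : C₂ * δ ≤ Real.sqrt m / 2 := by
    have h1 : δ ≤ Real.sqrt m / (2 * (C₂ + 1)) := (min_le_right _ _).trans (min_le_left _ _)
    have h2 : C₂ * δ ≤ C₂ * (Real.sqrt m / (2 * (C₂ + 1))) := mul_le_mul_of_nonneg_left h1 hC₂0
    have h3 : C₂ * (Real.sqrt m / (2 * (C₂ + 1))) ≤ Real.sqrt m / 2 := by
      have hle : C₂ / (C₂ + 1) ≤ 1 := by
        rw [div_le_one (by positivity)]; linarith only []
      calc C₂ * (Real.sqrt m / (2 * (C₂ + 1))) = C₂ * Real.sqrt m / (2 * (C₂ + 1)) :=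
            (mul_div_assoc _ _ _).symm
        _ = C₂ / (C₂ + 1) * (Real.sqrt m / 2) := by rw [div_mul_div_comm, mul_comm (C₂ + 1) 2]
        _ ≤ 1 * (Real.sqrt m / 2) := by gcongr
        _ = Real.sqrt m / 2 := one_mul _
    exact h2.trans h3
  have hδC₁ : C₁ * δ ≤ m / 2 := by
    have h1 : δ ≤ m / (2 * (C₁ + 1)) := (min_le_right _ _).trans (min_le_right _ _)
    have h2 : C₁ * δ ≤ C₁ * (m / (2 * (C₁ + 1))) := mul_le_mul_of_nonneg_left h1 hC₁0
    have h3 : C₁ * (m / (2 * (C₁ + 1))) ≤ m / 2 := by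
      have hle : C₁ / (C₁ + 1) ≤ 1 := by
        rw [div_le_one (by positivity)]; linarith only []
      calc C₁ * (m / (2 * (C₁ + 1))) = C₁ * m / (2 * (C₁ + 1)) := (mul_div_assoc _ _ _).symm
        _ = C₁ / (C₁ + 1) * (m / 2) := by rw [div_mul_div_comm, mul_comm (C₁ + 1) 2]
        _ ≤ 1 * (m / 2) := by gcongr
        _ = m / 2 := one_mul _
    exact h2.trans h3
  -- the half-ball of radius `δ` lies in `K`
  have hballK : H ∩ ball x₀ δ ⊆ K := by
    intro x hx
    refine ⟨mem_closedBall.2 ?_, hx.1⟩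
    have : dist x x₀ < δ := mem_ball.1 hx.2
    linarith only [this, hδ₁2, hδ₁]
  -- the constants
  set A : ℝ := 2 / Real.sqrt m with hA_def
  have hA0 : 0 ≤ A := div_nonneg zero_le_two hsm.le
  set B₀ : ℝ := C₁ + 2 * Cr * C₂ + C₂ ^ 2 with hB₀_def
  have hB₀0 : 0 ≤ B₀ := by positivity
  set B : ℝ := (B₀ / m + C₂ / Real.sqrt m + C₁ / m) * A with hB_def
  have hB0 : 0 ≤ B := by positivity
  /- Boundary analysis: at a point `y ∈ H ∩ ball x₀ δ` with `y i₀ = 0`, `D r(y) a = (a i₀) θ`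
    with `θ = D r(y) e ≥ √m`, and the unit normal `ν` of `hbd` satisfies `Q_y(ν, ·) = D r(y)`. -/
  have key : ∀ y ∈ H ∩ ball x₀ δ, y i₀ = 0 →
      r y = 0 ∧ (∀ a, r' y a = a i₀ * r' y e) ∧ Real.sqrt m ≤ r' y e ∧
        ∃ ν, Q y ν ν = 1 ∧ (∀ a, Q y ν a = r' y a) ∧ ‖ν‖ ^ 2 ≤ m⁻¹ := by
    intro y hy hy0
    have hyK : y ∈ K := hballK hy
    have hyT : y ∈ T := hKT hyK
    obtain ⟨hry, ν, hν1, hν2⟩ := hbd y hyT hy0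
    have hν2' : ∀ a, Q y ν a = r' y a := fun a ↦ by rw [hν2 a, hr'S y hyT]
    have hyd : dist y x₀ < δ := mem_ball.1 hy.2
    -- one-sided derivatives at the minimum `y` of `r`
    have hderiv : HasFDerivWithinAt r (r' y) T y := (hrdT y hyT).hasFDerivWithinAt
    have hsign : ∀ a : EuclideanSpace ℝ ι, 0 ≤ a i₀ → 0 ≤ r' y a := by
      intro a ha
      have hmemK : ∀ᶠ t in 𝓝[>] (0 : ℝ), y + t • a ∈ K := by
        have hsmall : ∀ᶠ t in 𝓝 (0 : ℝ), t * ‖a‖ < δ₁ / 2 := by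
          have hc : Continuous fun t : ℝ ↦ t * ‖a‖ := continuous_id.mul continuous_const
          have h0 : (fun t : ℝ ↦ t * ‖a‖) 0 < δ₁ / 2 := by simp [half_pos hδ₁]
          exact hc.continuousAt.eventually_lt continuousAt_const h0
        filter_upwards [mem_nhdsWithin_of_mem_nhds hsmall, self_mem_nhdsWithin] with t ht ht0
        have ht0' : (0 : ℝ) < t := ht0
        refine ⟨mem_closedBall.2 ?_, ?_⟩
        · calc dist (y + t • a) x₀ = ‖(y - x₀) + t • a‖ := by rw [dist_eq_norm]; abel_nf
            _ ≤ ‖y - x₀‖ + ‖t • a‖ := norm_add_le _ _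
            _ = dist y x₀ + t * ‖a‖ := by
                rw [dist_eq_norm, norm_smul, Real.norm_eq_abs, abs_of_pos ht0']
            _ ≤ δ₁ := by linarith only [hyd, ht, hδ₁2]
        · show 0 ≤ (y + t • a) i₀
          simp only [PiLp.add_apply, PiLp.smul_apply, smul_eq_mul, hy0, zero_add]
          exact mul_nonneg ht0'.le ha
      have hmem : ∀ᶠ t in 𝓝[>] (0 : ℝ), y + t • a ∈ T := hmemK.mono fun t ht ↦ hKT ht
      have hmin : ∀ᶠ t in 𝓝[>] (0 : ℝ), r y ≤ r (y + t • a) := by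
        filter_upwards [hmem] with t ht
        rw [hry]
        exact hr0 _ ht
      exact apply_nonneg_of_hasFDerivWithinAt_of_le hderiv hmem hmin
    -- tangential derivatives vanish
    have htan : ∀ a : EuclideanSpace ℝ ι, a i₀ = 0 → r' y a = 0 := by
      intro a ha
      have h1 : 0 ≤ r' y a := hsign a ha.ge
      have h2 : 0 ≤ r' y (-a) := hsign (-a) (by simp [ha])
      rw [map_neg] at h2
      linarith only [h1, h2]
    have hdec : ∀ a : EuclideanSpace ℝ ι, r' y a = a i₀ * r' y e := by
      intro a
      have hsplit : a = a i₀ • e + (a - a i₀ • e) := by abel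
      have ht0 : r' y (a - a i₀ • e) = 0 := htan _ (sub_smul_single_apply_self i₀ a)
      conv_lhs => rw [hsplit]
      rw [map_add, map_smul, smul_eq_mul, ht0, add_zero]
    -- `θ = D r(y) e > 0` and `ν i₀ θ = 1`
    have hθ0 : 0 ≤ r' y e := hsign e (by rw [hei]; exact zero_le_one)
    have hνθ : ν i₀ * r' y e = 1 := by rw [← hdec ν, ← hν2' ν, hν1]
    have hνnorm : ‖ν‖ ^ 2 ≤ m⁻¹ := by
      have h1 : m * ‖ν‖ ^ 2 ≤ 1 := by rw [← hν1]; exact hmQ y hyK ν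
      calc ‖ν‖ ^ 2 = m⁻¹ * (m * ‖ν‖ ^ 2) := by
            rw [← mul_assoc, inv_mul_cancel₀ hm.ne', one_mul]
        _ ≤ m⁻¹ * 1 := mul_le_mul_of_nonneg_left h1 (inv_nonneg.2 hm.le)
        _ = m⁻¹ := mul_one _
    have hθ : Real.sqrt m ≤ r' y e := by
      set θ : ℝ := r' y e with hθ_def
      have hνi : (ν i₀) ^ 2 ≤ m⁻¹ := by
        calc (ν i₀) ^ 2 = |ν i₀| ^ 2 := (sq_abs _).symm
          _ ≤ ‖ν‖ ^ 2 :=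
              pow_le_pow_left₀ (abs_nonneg _) ((Real.norm_eq_abs _).symm.trans_le
                (PiLp.norm_apply_le ν i₀)) 2
          _ ≤ m⁻¹ := hνnorm
      have hθpos : 0 < θ := by
        rcases hθ0.eq_or_lt with h | h
        · exfalso
          rw [← h, mul_zero] at hνθ
          exact zero_ne_one hνθ
        · exact h
      -- `θ² ≥ m` from `(ν i₀ θ)² = 1` and `(ν i₀)² ≤ 1/m`
      have hsq : m ≤ θ ^ 2 := by
        have h1 : (ν i₀) ^ 2 * θ ^ 2 = 1 := by rw [← mul_pow, hνθ, one_pow]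
        have h2 : m * (ν i₀) ^ 2 ≤ 1 := by
          calc m * (ν i₀) ^ 2 ≤ m * m⁻¹ := mul_le_mul_of_nonneg_left hνi hm.le
            _ = 1 := mul_inv_cancel₀ hm.ne'
        calc m = m * ((ν i₀) ^ 2 * θ ^ 2) := by rw [h1, mul_one]
          _ = (m * (ν i₀) ^ 2) * θ ^ 2 := by ring
          _ ≤ 1 * θ ^ 2 := mul_le_mul_of_nonneg_right h2 (sq_nonneg _)
          _ = θ ^ 2 := one_mul _
      calc Real.sqrt m ≤ Real.sqrt (θ ^ 2) := Real.sqrt_le_sqrt hsq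
        _ = θ := Real.sqrt_sq hθpos.le
    exact ⟨hry, hdec, hθ, ν, hν1, hν2', hνnorm⟩
  -- the boundary projection of a point of the half-ball stays in the half-ball
  have hproj : ∀ x ∈ H ∩ ball x₀ δ, x - x i₀ • e ∈ H ∩ ball x₀ δ ∧ (x - x i₀ • e) i₀ = 0 ∧
      ‖x - (x - x i₀ • e)‖ = x i₀ ∧ x i₀ < δ := by
    intro x hx
    have hxi : 0 ≤ x i₀ := hx.1
    have hxd : ‖x - x₀‖ < δ := by rw [← dist_eq_norm]; exact mem_ball.1 hx.2
    have h0 : (x - x i₀ • e) i₀ = 0 := sub_smul_single_apply_self i₀ x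
    have hnorm : ‖(x - x i₀ • e) - x₀‖ ≤ ‖x - x₀‖ := by
      have h1 : (x - x i₀ • e) - x₀ = (x - x₀) - (x - x₀) i₀ • e := by
        simp only [PiLp.sub_apply, hx₀0, sub_zero]
        abel
      rw [h1]
      exact norm_sub_smul_single_le i₀ (x - x₀)
    have hxi' : x i₀ ≤ ‖x - x₀‖ := by
      have h1 : x i₀ = (x - x₀) i₀ := by simp [hx₀0]
      rw [h1]
      exact (le_abs_self _).trans ((Real.norm_eq_abs _).symm.trans_le (PiLp.norm_apply_le _ i₀))
    refine ⟨⟨h0.ge, ?_⟩, h0, ?_, hxi'.trans_lt hxd⟩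
    · rw [mem_ball, dist_eq_norm]
      exact hnorm.trans_lt hxd
    · rw [sub_sub_cancel, norm_smul_single_one, abs_of_nonneg hxi]
  -- main estimates
  refine ⟨δ, A, B, hδpos, hA0, hB0, fun x hx ↦ hKT (hballK hx), fun x hx ↦ ?_⟩
  obtain ⟨hxbm, hxb0, hdist, hxiδ⟩ := hproj x hx
  set xb : EuclideanSpace ℝ ι := x - x i₀ • e with hxb_def
  obtain ⟨hrxb, hdec, hθ, ν, hν1, hν2, hνnorm⟩ := key xb hxbm hxb0
  have hxK : x ∈ K := hballK hx
  have hxbK : xb ∈ K := hballK hxbm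
  have hxT : x ∈ T := hKT hxK
  have hxbT : xb ∈ T := hKT hxbK
  have hxi : 0 ≤ x i₀ := hx.1
  have hxi1 : x i₀ ≤ 1 := hxiδ.le.trans hδ1
  have hrx : 0 ≤ r x := hr0 x hxT
  -- Lipschitz bounds between `x` and its projection
  have hQd : ‖Q x - Q xb‖ ≤ C₁ * x i₀ := by rw [← hdist]; exact hQlip xb hxbK x hxK
  have hr'd : ‖r' x - r' xb‖ ≤ C₂ * x i₀ := by rw [← hdist]; exact hr'lip xb hxbK x hxK
  have hQxb_nonneg : ∀ a, 0 ≤ Q xb a a := fun a ↦ by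
    by_cases ha : a = 0
    · subst ha; simp
    · exact (hQpos xb hxbT a ha).le
  have hQx_ell : ∀ a, m * ‖a‖ ^ 2 ≤ Q x a a := fun a ↦ hmQ x hxK a
  -- componentwise consequences of the Lipschitz bounds
  have hQdiff : ∀ a, |Q x a a - Q xb a a| ≤ C₁ * x i₀ * ‖a‖ ^ 2 := by
    intro a
    have h1 : Q x a a - Q xb a a = (Q x - Q xb) a a := by
      simp only [sub_apply]
    rw [h1, ← Real.norm_eq_abs]
    calc ‖(Q x - Q xb) a a‖ ≤ ‖Q x - Q xb‖ * ‖a‖ * ‖a‖ := (Q x - Q xb).le_opNorm₂ a a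
      _ ≤ C₁ * x i₀ * ‖a‖ * ‖a‖ := by gcongr
      _ = C₁ * x i₀ * ‖a‖ ^ 2 := by ring
  have hr'diff : ∀ a, |r' x a - r' xb a| ≤ C₂ * x i₀ * ‖a‖ := by
    intro a
    have h1 : r' x a - r' xb a = (r' x - r' xb) a := by
      simp only [sub_apply]
    rw [h1, ← Real.norm_eq_abs]
    calc ‖(r' x - r' xb) a‖ ≤ ‖r' x - r' xb‖ * ‖a‖ := (r' x - r' xb).le_opNorm a
      _ ≤ C₂ * x i₀ * ‖a‖ := by gcongr
  -- (a) the defining function dominates the boundary coordinate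
  have ha : x i₀ ≤ A * r x := by
    rcases hxi.eq_or_lt with h0 | hpos
    · rw [← h0]; positivity
    -- the vertical segment `φ t = r (xb + t (x - xb))`
    set v : EuclideanSpace ℝ ι := x i₀ • e with hv_def
    have hxv : xb + v = x := by rw [hxb_def, hv_def]; abel
    have hxv' : x - xb = v := by rw [← hxv]; abel
    set φ : ℝ → ℝ := fun t ↦ r (xb + t • v) with hφ_def
    -- points of the open segment are interior points of `T`
    have hseg : ∀ t ∈ Icc (0 : ℝ) 1, xb + t • v ∈ K := by
      intro t ht
      rw [← hxv']
      exact hKconv.add_smul_sub_mem hxbK hxK ht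
    have hsegT : ∀ t ∈ Ioo (0 : ℝ) 1, T ∈ 𝓝 (xb + t • v) := by
      intro t ht
      have hO : IsOpen ({y : EuclideanSpace ℝ ι | 0 < y i₀} ∩ ball x₀ δ₁) :=
        (isOpen_lt continuous_const (continuous_apply_coord i₀)).inter isOpen_ball
      have hOT : {y : EuclideanSpace ℝ ι | 0 < y i₀} ∩ ball x₀ δ₁ ⊆ T := fun y hy ↦
        hKT ⟨mem_closedBall.2 (mem_ball.1 hy.2).le, show (0 : ℝ) ≤ y i₀ from le_of_lt hy.1⟩
      refine Filter.mem_of_superset (hO.mem_nhds ⟨?_, ?_⟩) hOT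
      · show 0 < (xb + t • v) i₀
        simp only [PiLp.add_apply, PiLp.smul_apply, smul_eq_mul, hxb0, zero_add, hv_def, hei,
          mul_one]
        exact mul_pos ht.1 hpos
      · have h1 : xb + t • v ∈ ball x₀ δ := by
          rw [← hxv']
          exact (convex_ball x₀ δ).add_smul_sub_mem hxbm.2 hx.2 ⟨ht.1.le, ht.2.le⟩
        exact ball_subset_ball (by linarith only [hδ₁2, hδ₁]) h1
    have hφd : ∀ t ∈ Ioo (0 : ℝ) 1, HasDerivAt φ (r' (xb + t • v) v) t := by
      intro t ht
      have hTn := hsegT t ht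
      have hdiff : DifferentiableAt ℝ r (xb + t • v) :=
        (hrdT _ (mem_of_mem_nhds hTn)).differentiableAt hTn
      have hline : HasDerivAt (fun s : ℝ ↦ xb + s • v) v t := by
        have h := ((hasDerivAt_id t).smul_const v).const_add xb
        rwa [one_smul] at h
      have hcomp := hdiff.hasFDerivAt.comp_hasDerivAt t hline
      have hfd : fderiv ℝ r (xb + t • v) = r' (xb + t • v) := by
        rw [hr'_def, fderivWithin_of_mem_nhds hTn]
      rw [hfd] at hcomp
      exact hcomp
    have hφc : ContinuousOn φ (Icc 0 1) := by
      have hline : Continuous fun s : ℝ ↦ xb + s • v := by fun_prop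
      exact hrc.comp hline.continuousOn fun t ht ↦ hKT (hseg t ht)
    have hφdiff : DifferentiableOn ℝ φ (interior (Icc (0 : ℝ) 1)) := by
      rw [interior_Icc]
      exact fun t ht ↦ (hφd t ht).differentiableAt.differentiableWithinAt
    -- lower bound for the derivative
    have hφ' : ∀ t ∈ interior (Icc (0 : ℝ) 1), x i₀ * (Real.sqrt m / 2) ≤ deriv φ t := by
      rw [interior_Icc]
      intro t ht
      rw [(hφd t ht).deriv]
      have hzK : xb + t • v ∈ K := hseg t ⟨ht.1.le, ht.2.le⟩
      have hlip : ‖r' (xb + t • v) - r' xb‖ ≤ C₂ * x i₀ := by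
        calc ‖r' (xb + t • v) - r' xb‖ ≤ C₂ * ‖xb + t • v - xb‖ := hr'lip xb hxbK _ hzK
          _ = C₂ * (t * x i₀) := by
              rw [add_sub_cancel_left, norm_smul, hv_def, norm_smul_single_one,
                Real.norm_eq_abs, abs_of_pos ht.1, abs_of_nonneg hxi]
          _ ≤ C₂ * (1 * x i₀) := by gcongr; exact ht.2.le
          _ = C₂ * x i₀ := by rw [one_mul]
      have hcomp : |r' (xb + t • v) e - r' xb e| ≤ C₂ * x i₀ := by
        have h1 : r' (xb + t • v) e - r' xb e = (r' (xb + t • v) - r' xb) e := by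
          simp only [sub_apply]
        rw [h1, ← Real.norm_eq_abs]
        calc ‖(r' (xb + t • v) - r' xb) e‖ ≤ ‖r' (xb + t • v) - r' xb‖ * ‖e‖ :=
              (r' (xb + t • v) - r' xb).le_opNorm e
          _ ≤ C₂ * x i₀ * 1 := by rw [he1]; gcongr
          _ = C₂ * x i₀ := mul_one _
      have hge : Real.sqrt m / 2 ≤ r' (xb + t • v) e := by
        have h1 : r' xb e - C₂ * x i₀ ≤ r' (xb + t • v) e := by
          have h0 := (abs_le.1 hcomp).1; linarith only [h0]
        have h2 : C₂ * x i₀ ≤ Real.sqrt m / 2 :=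
          (mul_le_mul_of_nonneg_left hxiδ.le hC₂0).trans hδC₂
        linarith only [h1, h2, hθ]
      have hval : r' (xb + t • v) v = x i₀ * r' (xb + t • v) e := by
        rw [hv_def, map_smul, smul_eq_mul]
      rw [hval]
      exact mul_le_mul_of_nonneg_left hge hxi
    have hmvt := (convex_Icc (0 : ℝ) 1).mul_sub_le_image_sub_of_le_deriv hφc hφdiff hφ'
      0 (left_mem_Icc.2 zero_le_one) 1 (right_mem_Icc.2 zero_le_one) zero_le_one
    have hφ0 : φ 0 = 0 := by simp [hφ_def, hrxb]
    have hφ1 : φ 1 = r x := by simp [hφ_def, hxv]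
    rw [hφ0, hφ1, sub_zero, sub_zero, mul_one] at hmvt
    -- `x i₀ √m / 2 ≤ r x`
    rw [hA_def]
    calc x i₀ = (x i₀ * (Real.sqrt m / 2)) * (2 / Real.sqrt m) := by
          field_simp
      _ ≤ r x * (2 / Real.sqrt m) := by gcongr
      _ = 2 / Real.sqrt m * r x := mul_comm _ _
  have hxiA : x i₀ ≤ A * r x := ha
  refine ⟨ha, fun a ↦ ?_, ?_⟩
  · -- (b) `(D r(x) a)² ≤ (1 + B r x) Q_x(a, a)`
    have hCS : (r' xb a) ^ 2 ≤ Q xb a a := by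
      have h := sq_apply_le_mul_apply_of_nonneg (Q xb) (hQsymm xb hxbT) hQxb_nonneg ν a
      rw [hν1, one_mul, hν2 a] at h
      exact h
    have hpb : |r' xb a| ≤ Cr * ‖a‖ := by
      rw [← Real.norm_eq_abs]
      exact ((r' xb).le_opNorm a).trans (mul_le_mul_of_nonneg_right (hCr xb hxbK) (norm_nonneg _))
    have h1 := hr'diff a
    have h2 := hQdiff a
    have hq := hQx_ell a
    set s := x i₀
    set na := ‖a‖
    have hna0 : 0 ≤ na := norm_nonneg _
    -- `|p| ≤ |p̄| + C₂ s ‖a‖`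
    have hp : |r' x a| ≤ |r' xb a| + C₂ * s * na := by
      have h0 := abs_sub_abs_le_abs_sub (r' x a) (r' xb a); linarith only [h0, h1]
    have hp2 : (r' x a) ^ 2 ≤ (|r' xb a| + C₂ * s * na) ^ 2 := by
      calc (r' x a) ^ 2 = |r' x a| ^ 2 := (sq_abs _).symm
        _ ≤ (|r' xb a| + C₂ * s * na) ^ 2 :=
            pow_le_pow_left₀ (abs_nonneg _) hp 2
    have hstep : (|r' xb a| + C₂ * s * na) ^ 2 ≤ Q x a a + B₀ * s * na ^ 2 := by
      have e1 : (|r' xb a| + C₂ * s * na) ^ 2 =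
          (r' xb a) ^ 2 + 2 * |r' xb a| * (C₂ * s * na) + (C₂ * s * na) ^ 2 := by
        rw [add_sq, sq_abs]
      have e2 : 2 * |r' xb a| * (C₂ * s * na) ≤ 2 * (Cr * na) * (C₂ * s * na) := by
        gcongr
      have e3 : (C₂ * s * na) ^ 2 ≤ C₂ ^ 2 * s * na ^ 2 := by
        have : s ^ 2 ≤ s := by nlinarith only [hxi, hxi1]
        calc (C₂ * s * na) ^ 2 = C₂ ^ 2 * s ^ 2 * na ^ 2 := by ring
          _ ≤ C₂ ^ 2 * s * na ^ 2 := by gcongr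
      have e4 : Q xb a a ≤ Q x a a + C₁ * s * na ^ 2 := by
        have h0 := (abs_le.1 h2).1; linarith only [h0]
      calc (|r' xb a| + C₂ * s * na) ^ 2
          ≤ Q xb a a + 2 * (Cr * na) * (C₂ * s * na) + C₂ ^ 2 * s * na ^ 2 := by
            rw [e1]; linarith only [hCS, e2, e3]
        _ ≤ Q x a a + C₁ * s * na ^ 2 + 2 * (Cr * na) * (C₂ * s * na) + C₂ ^ 2 * s * na ^ 2 := by
            linarith only [e4]
        _ = Q x a a + B₀ * s * na ^ 2 := by rw [hB₀_def]; ring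
    have hfin : Q x a a + B₀ * s * na ^ 2 ≤ (1 + B * r x) * Q x a a := by
      have hq0 : 0 ≤ Q x a a := (mul_nonneg hm.le (sq_nonneg _)).trans hq
      have e1 : B₀ * s * na ^ 2 ≤ B₀ * s * (Q x a a / m) := by
        have : na ^ 2 ≤ Q x a a / m := by rw [le_div_iff₀ hm]; linarith only [hq]
        have hB₀s : 0 ≤ B₀ * s := mul_nonneg hB₀0 hxi
        exact mul_le_mul_of_nonneg_left this hB₀s
      have e2 : B₀ * s * (Q x a a / m) = (B₀ / m) * s * Q x a a := by
        field_simp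
      have e3 : (B₀ / m) * s * Q x a a ≤ (B₀ / m) * (A * r x) * Q x a a := by
        have : 0 ≤ B₀ / m := div_nonneg hB₀0 hm.le
        gcongr
      have e4 : (B₀ / m) * A ≤ B := by
        rw [hB_def]
        have h4 : 0 ≤ C₂ / Real.sqrt m := by positivity
        have h5 : 0 ≤ C₁ / m := by positivity
        exact mul_le_mul_of_nonneg_right (by linarith only [h4, h5]) hA0
      have e5 : (B₀ / m) * (A * r x) * Q x a a ≤ B * r x * Q x a a := by
        have : (B₀ / m) * (A * r x) = ((B₀ / m) * A) * r x := by ring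
        rw [this]
        gcongr
      calc Q x a a + B₀ * s * na ^ 2 ≤ Q x a a + B₀ * s * (Q x a a / m) := by linarith only [e1]
        _ = Q x a a + (B₀ / m) * s * Q x a a := by rw [e2]
        _ ≤ Q x a a + (B₀ / m) * (A * r x) * Q x a a := by linarith only [e3]
        _ ≤ Q x a a + B * r x * Q x a a := by linarith only [e5]
        _ = (1 + B * r x) * Q x a a := by ring
    rw [← hr'S x hxT]
    exact hp2.trans (hstep.trans hfin)
  · -- (c) a `Q_x`-unit vector on which `D r(x)` is at least `1 − B r x`
    set s := x i₀
    set σ : ℝ := Q x ν ν with hσ_def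
    have hν0 : ν ≠ 0 := by
      intro h0; rw [h0] at hν1; simp at hν1
    have hσpos : 0 < σ := hQpos x hxT ν hν0
    have hsσ : 0 < Real.sqrt σ := Real.sqrt_pos.2 hσpos
    -- `σ ≤ 1 + C₁ s / m`
    set qq : ℝ := C₁ * s / m with hqq_def
    set pp : ℝ := C₂ * s / Real.sqrt m with hpp_def
    have hqq0 : 0 ≤ qq := by positivity
    have hpp0 : 0 ≤ pp := by positivity
    have hqq1 : qq ≤ 1 / 2 := by
      rw [hqq_def, div_le_iff₀ hm]
      have h0 : C₁ * s ≤ C₁ * δ := mul_le_mul_of_nonneg_left hxiδ.le hC₁0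
      linarith only [h0, hδC₁]
    have hpp1 : pp ≤ 1 / 2 := by
      rw [hpp_def, div_le_iff₀ hsm]
      have h0 : C₂ * s ≤ C₂ * δ := mul_le_mul_of_nonneg_left hxiδ.le hC₂0
      linarith only [h0, hδC₂]
    have hσle : σ ≤ 1 + qq := by
      have h2 := hQdiff ν
      have h3 : C₁ * s * ‖ν‖ ^ 2 ≤ qq := by
        rw [hqq_def]
        calc C₁ * s * ‖ν‖ ^ 2 ≤ C₁ * s * m⁻¹ :=
              mul_le_mul_of_nonneg_left hνnorm (mul_nonneg hC₁0 hxi)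
          _ = C₁ * s / m := by rw [div_eq_mul_inv]
      have h0 := (abs_le.1 h2).2
      rw [hσ_def]; linarith only [h0, h3, hν1]
    -- `D r(x) ν ≥ 1 − pp`
    have hpν : 1 - pp ≤ r' x ν := by
      have h1 := hr'diff ν
      have h3 : C₂ * s * ‖ν‖ ≤ pp := by
        rw [hpp_def]
        have hνn : ‖ν‖ ≤ (Real.sqrt m)⁻¹ := by
          have h4 : ‖ν‖ ^ 2 ≤ ((Real.sqrt m)⁻¹) ^ 2 := by
            rw [inv_pow, Real.sq_sqrt hm.le]; exact hνnorm
          exact (pow_le_pow_iff_left₀ (norm_nonneg _) (by positivity) two_ne_zero).1 h4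
        calc C₂ * s * ‖ν‖ ≤ C₂ * s * (Real.sqrt m)⁻¹ :=
              mul_le_mul_of_nonneg_left hνn (mul_nonneg hC₂0 hxi)
          _ = C₂ * s / Real.sqrt m := by rw [div_eq_mul_inv]
      have h5 : r' xb ν = 1 := by rw [← hν2 ν, hν1]
      have h0 := (abs_le.1 h1).1
      linarith only [h0, h3, h5]
    -- the normalised vector
    set a₀ : EuclideanSpace ℝ ι := (Real.sqrt σ)⁻¹ • ν with ha₀_def
    refine ⟨a₀, ?_, ?_⟩
    · rw [ha₀_def, map_smul, map_smul, smul_apply, smul_eq_mul, smul_eq_mul,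
        ← hσ_def, ← mul_assoc, ← mul_inv, Real.mul_self_sqrt hσpos.le, inv_mul_cancel₀ hσpos.ne']
    · rw [← hr'S x hxT, ha₀_def, map_smul, smul_eq_mul]
      -- `(√σ)⁻¹ ≥ 1 − qq`
      have hinv : 1 - qq ≤ (Real.sqrt σ)⁻¹ := by
        have h1pos : 0 < 1 + qq := by linarith only [hqq0]
        have h1 : Real.sqrt σ ≤ 1 + qq := by
          calc Real.sqrt σ ≤ Real.sqrt (1 + qq) := Real.sqrt_le_sqrt hσle
            _ ≤ 1 + qq := by
                rw [Real.sqrt_le_left h1pos.le]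
                nlinarith only [hqq0]
        have h2 : (1 + qq)⁻¹ ≤ (Real.sqrt σ)⁻¹ := (inv_le_inv₀ h1pos hsσ).2 h1
        have h3 : 1 - qq ≤ (1 + qq)⁻¹ := by
          rw [← one_div, le_div_iff₀ h1pos]
          nlinarith only [sq_nonneg qq]
        exact h3.trans h2
      have hprod : (1 - qq) * (1 - pp) ≤ (Real.sqrt σ)⁻¹ * r' x ν :=
        mul_le_mul hinv hpν (by linarith only [hpp1]) (by positivity)
      have hlin : 1 - B * r x ≤ (1 - qq) * (1 - pp) := by
        have e1 : 1 - (qq + pp) ≤ (1 - qq) * (1 - pp) := by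
          nlinarith only [mul_nonneg hqq0 hpp0]
        have e2 : qq + pp = (C₁ / m + C₂ / Real.sqrt m) * s := by
          rw [hqq_def, hpp_def]; ring
        have e3 : (C₁ / m + C₂ / Real.sqrt m) * s ≤ (C₁ / m + C₂ / Real.sqrt m) * (A * r x) := by
          have : 0 ≤ C₁ / m + C₂ / Real.sqrt m := by positivity
          exact mul_le_mul_of_nonneg_left hxiA this
        have e4 : (C₁ / m + C₂ / Real.sqrt m) * A ≤ B := by
          rw [hB_def]
          have h6 : 0 ≤ B₀ / m := by positivity
          exact mul_le_mul_of_nonneg_right (by linarith only [h6]) hA0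
        have e5 : (C₁ / m + C₂ / Real.sqrt m) * (A * r x) ≤ B * r x := by
          rw [← mul_assoc]
          exact mul_le_mul_of_nonneg_right e4 hrx
        linarith only [e1, e2, e3, e5]
      exact hlin.trans hprod

end Estimates

end ConformallyCompact

end Literature.Geometry.Riemannian

end
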